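import Summits.ABC.IUTFork.DAGL1d
import Summits.ABC.IUTFork.DAGL1p
import Summits.ABC.IUTFork.DAGL1q
import Summits.ABC.IUTFork.DAGL1r
import Summits.ABC.IUTFork.DAGL1w
import Summits.ABC.IUTFork.DAGL1x
import Summits.ABC.IUTFork.DAGL1z
import Summits.ABC.IUTFork.DAGRf
import Summits.ABC.IUTFork.DAGUa
import Summits.ABC.IUTFork.DAGUb
import HarnessLib

/-!
# L1 LAYER CERTIFICATE, part A — the [FrdI] §1–§3 members of the Cor 3.12 cone, packaged BY NAME over the kernel DAG index

abc-iut cell, director-abc (C2) «Conditional/Layer<k>OfS»; abc-iut-L1-lead R121 (5) «CERT-L1 part 1» (holder abc-iut-L1-d4 gen 5), in the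
grammar of `Conditional/Layer6OfSa.lean` (abc-iut-L6-lead spec plan/L6/CERT-L6.md). NODE LIST OF RECORD = plan/CONE-BOARD.tsv ⋈ plan/COR312-CONE.tsv
(L1 cone = 176 nodes; this part = the 84 [FrdI] §1–§3 members); STATUS SOURCE = plan/L1/NODES.md (overlay #43, 2026-08-26T06:40Z; where
CONE-BOARD disagrees, NODES wins); KERNEL INDEX = abc-iut-c312-2's `Summits/ABC/IUTFork/DAGL1*.lean` (+ sub-DAG rows in DAGL1x); FILE-OF-RECORD
keying = plan/L1/CONE-FREEZE-L1.tsv (R121 (6): index entries keyed to another item's declarations are LISTED AS FINDINGS, never cited).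

THIS FILE PROVES NOTHING NEW AND ASSERTS NOTHING: every conjunct is an index Prop `N_<id>` / index sub-row Prop BY NAME (universe-instantiated
with the index's level names) and every witness is the index's own `_holds` / `_part` term BY NAME — no tactic proof of content, no restatement,
no new `def … : Prop` fact, no `instance`, no schema ∀-closed. It PACKAGES the [FrdI] §1–§3 slice of the L1 cone into ONE discharged
conjunction and ONE residual conjunction for the apex `Conditional/AbcOfS` (via the top file `Conditional/Layer1OfS.lean`).

COUNT LINE («nodes = d + r + d_data + findings»): **84 = d 43 (NODES-DISCHARGED claim nodes, incl. DISCHARGED-(H), DISCHARGED-partial, DISCHARGED-conditional as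
tagged per line) + r 7 (Residual: claim-form index Props of nodes NODES does not mark discharged — Definitions typed ACCEPTED, Prop 2.2 (ii)/(iii))
+ d_data 30 (data-form index aliases of definitions / structures / Prop-valued SCHEMAS over binders — LISTED and name-checked below, never
conjoined, never ∀-closed) + findings 4 (R121 (6) / F-w6d007-1: `N_FrdI_Def3_1_i…iv` are keyed to [FrdII] Def 3.1 declarations
(`ArchFrd.real_ringHom_eq_id`, …) — WRONG PAPER; the decls of record for [FrdI] Def 3.1 live in `BaseCategoryTheoreticityDefs.lean`
(`IsOfQuasiIsotropicType`, `IsOfStandardType`, `IsFrobeniusSlim`, `PerfectionData`, `UnitEquiv`/`Untr`); these four nodes are neither conjoined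
nor counted as discharged here until the index is re-keyed).** 43 + 7 + 30 + 4 = 84. Discharge SUB-ROWS with `_holds` (sub-DAG rows of
Thm 3.4 (iii) L01/L03–L07, Thm 3.4 (v) L12o, Prop 2.2 P22 L01/L11) enter `Layer1DischargedA` next to their node (K4-exception of the L6 grammar).
Further keying FINDINGS (data-form, harmless because only name-checked): `N_FrdI_Thm3_4_i := @PreFrobenioidData.PreservesObj` and
`N_FrdI_Thm3_4_v := @PreFrobenioidData.PreservesRel` alias generic vocabulary of `PreFrobenioidData.lean`, not the typed `Thm34i` / `Thm34v` of
`BaseCategoryTheoreticity.lean` (file of record) — index owner please re-key; the node-level discharges of Thm 3.4 (i)/(v) are therefore represented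
here only by the sub-row `N_FrdI_Thm3_4_v_L12o` and the NODES tags.
KERNEL NOTE (honest): every index claim Prop is a `StatementOf` conjunction of LANDED theorems, so each RESIDUAL conjunct is kernel-inhabited by the
index's `_part`/`_holds`; «discharged vs residual» is the NODES row STATUS (the layer lead's judgement that the typed theorems cover the printed
item), not kernel provability; no residual conjunct is an open kernel obligation. S (`PilotKummerIndRelated`) is NOT consumed at L1; FACT-LIST rows
enter only as hypotheses INSIDE the conjoined statements (instance forms), never as free hypotheses of this file.
HONEST FRAMING: typed ≠ proved; indexed ≠ endorsed; witnessed ≠ lead-discharged; nothing here asserts that abc is proved or refuted or takes a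
side on [IUTchIII] Cor. 3.12. [claim: Mochizuki2012, status: disputed] (node texts: [FrdI] = Mochizuki, Kyushu J. Math. 62 (2008) 293–400).

d_data — LISTED (index alias := declaration; NODES status; index part):
* FrdI:Def1.1(iv) — `N_FrdI_Def1_1_iv` (DAGL1d); NODES=ACCEPTED
* FrdI:Def1.2(i) — `N_FrdI_Def1_2_i` (DAGL1d); NODES=ACCEPTED
* FrdI:Def1.2(ii) — `N_FrdI_Def1_2_ii` (DAGL1d); NODES=ACCEPTED
* FrdI:Def1.2(iii) — `N_FrdI_Def1_2_iii` (DAGL1d); NODES=ACCEPTED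
* FrdI:Def1.2(iv) — `N_FrdI_Def1_2_iv` (DAGL1d); NODES=ACCEPTED
* FrdI:Def1.2(v) — `N_FrdI_Def1_2_v` (DAGL1d); NODES=ACCEPTED
* FrdI:Def1.3(ii) — `N_FrdI_Def1_3_ii` (DAGL1w); NODES=ACCEPTED
* FrdI:Def1.3(iii) — `N_FrdI_Def1_3_iii` (DAGL1d); NODES=ACCEPTED
* FrdI:Def1.3(iv) — `N_FrdI_Def1_3_iv` (DAGL1w); NODES=ACCEPTED
* FrdI:Def1.3(vi) — `N_FrdI_Def1_3_vi` (DAGL1w); NODES=ACCEPTED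
* FrdI:Def1.3(vii) — `N_FrdI_Def1_3_vii` (DAGL1p); NODES=ACCEPTED
* FrdI:Def2.4(i) — `N_FrdI_Def2_4_i` (DAGL1d); NODES=DISCHARGED
* FrdI:Def2.7(ii) — `N_FrdI_Def2_7_ii` (DAGL1r); NODES=DISCHARGED
* FrdI:Def2.7(iii) — `N_FrdI_Def2_7_iii` (DAGL1r); NODES=DISCHARGED
* FrdI:Def2.8(i) — `N_FrdI_Def2_8_i` (DAGL1d); NODES=DISCHARGED
* FrdI:Def2.8(ii) — `N_FrdI_Def2_8_ii` (DAGL1d); NODES=DISCHARGED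
* FrdI:Def2.8(iii) — `N_FrdI_Def2_8_iii` (DAGL1d); NODES=DISCHARGED
* FrdI:Prop2.1(iii) — `N_FrdI_Prop2_1_iii` (DAGL1r); NODES=DISCHARGED
* FrdI:Prop2.5(ii) — `N_FrdI_Prop2_5_ii` (DAGL1r); NODES=DISCHARGED
* FrdI:Prop2.9(i) — `N_FrdI_Prop2_9_i` (DAGL1r); NODES=DISCHARGED
* FrdI:Prop3.2(i) — `N_FrdI_Prop3_2_i` (DAGL1r); NODES=DISCHARGED
* FrdI:Prop3.2(ii) — `N_FrdI_Prop3_2_ii` (DAGL1r); NODES=DISCHARGED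
* FrdI:Prop3.2(iii) — `N_FrdI_Prop3_2_iii` (DAGL1r); NODES=DISCHARGED-(H)
* FrdI:Prop3.3(i) — `N_FrdI_Prop3_3_i` (DAGL1r); NODES=ACCEPTED
* FrdI:Prop3.3(iv) — `N_FrdI_Prop3_3_iv` (DAGL1r); NODES=DISCHARGED
* FrdI:Thm3.4(i) — `N_FrdI_Thm3_4_i` (DAGL1d); NODES=DISCHARGED
* FrdI:Thm3.4(ii) — `N_FrdI_Thm3_4_ii` (DAGL1r); NODES=DISCHARGED
* FrdI:Thm3.4(iii) — `N_FrdI_Thm3_4_iii` (DAGL1r); NODES=DISCHARGED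
* FrdI:Thm3.4(iv) — `N_FrdI_Thm3_4_iv` (DAGL1r); NODES=DISCHARGED-partial
* FrdI:Thm3.4(v) — `N_FrdI_Thm3_4_v` (DAGL1d); NODES=DISCHARGED-conditional
-/

namespace Summit.ABC.IUTFork.Conditional

open Summit.ABC.IUTFork.DAG

universe u₁ u₂ u₃ u₄ u₅

/-- **L1 discharged, part A** ([FrdI] §1–§3): the index Props of the NODES-DISCHARGED cone nodes (+ discharge sub-rows), BY NAME.
[claim: Mochizuki2012, status: disputed] -/
def Layer1DischargedA : Prop :=
  N_FrdI_Cor2_6.{u₁, u₂, u₃, u₄, u₅} -- FrdI:Cor2.6 · NODES=DISCHARGED · DAGL1z · `_holds`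
  ∧ N_FrdI_Def2_3_iv.{u₁, u₂, u₃, u₄, u₅} -- FrdI:Def2.3(iv) · NODES=DISCHARGED · DAGL1r · `_holds`
  ∧ N_FrdI_Def2_4_ii.{u₁} -- FrdI:Def2.4(ii) · NODES=DISCHARGED · DAGL1r · `_holds`
  ∧ N_FrdI_Def2_4_iii.{u₁, u₂, u₃} -- FrdI:Def2.4(iii) · NODES=DISCHARGED · DAGL1d · `_holds`
  ∧ N_FrdI_Def2_7_i.{u₁, u₂} -- FrdI:Def2.7(i) · NODES=DISCHARGED · DAGL1d · `_holds`
  ∧ N_FrdI_Prop1_10_i.{u₁, u₂, u₃, u₄, u₅} -- FrdI:Prop1.10(i) · NODES=DISCHARGED · DAGL1q · `_holds`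
  ∧ N_FrdI_Prop1_10_ii.{u₁, u₂, u₃, u₄, u₅} -- FrdI:Prop1.10(ii) · NODES=DISCHARGED · DAGL1q · `_holds`
  ∧ N_FrdI_Prop1_10_iii.{u₁, u₂, u₃, u₄, u₅} -- FrdI:Prop1.10(iii) · NODES=DISCHARGED · DAGL1q · `_holds`
  ∧ N_FrdI_Prop1_10_iv.{u₁, u₂, u₃, u₄, u₅} -- FrdI:Prop1.10(iv) · NODES=DISCHARGED · DAGL1q · `_holds`
  ∧ N_FrdI_Prop1_10_v.{u₁, u₂, u₃, u₄, u₅} -- FrdI:Prop1.10(v) · NODES=DISCHARGED · DAGL1q · `_holds`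
  ∧ N_FrdI_Prop1_10_vi.{u₁, u₂, u₃, u₄, u₅} -- FrdI:Prop1.10(vi) · NODES=DISCHARGED · DAGL1q · `_holds`
  ∧ N_FrdI_Prop1_11_i.{u₁, u₂, u₃, u₄, u₅} -- FrdI:Prop1.11(i) · NODES=DISCHARGED · DAGL1q · `_holds`
  ∧ N_FrdI_Prop1_11_ii.{u₁, u₂, u₃, u₄, u₅} -- FrdI:Prop1.11(ii) · NODES=DISCHARGED · DAGL1q · `_holds`
  ∧ N_FrdI_Prop1_11_iii.{u₁, u₂, u₃, u₄, u₅} -- FrdI:Prop1.11(iii) · NODES=DISCHARGED · DAGL1q · `_holds`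
  ∧ N_FrdI_Prop1_11_iv.{u₁, u₂, u₃, u₄, u₅} -- FrdI:Prop1.11(iv) · NODES=DISCHARGED · DAGL1q · `_holds`
  ∧ N_FrdI_Prop1_11_v.{u₁, u₂, u₃, u₄, u₅} -- FrdI:Prop1.11(v) · NODES=DISCHARGED · DAGL1q · `_holds`
  ∧ N_FrdI_Prop1_11_vi.{u₁, u₂, u₃, u₄, u₅} -- FrdI:Prop1.11(vi) · NODES=DISCHARGED · DAGL1q · `_holds`
  ∧ N_FrdI_Prop1_11_vii.{u₁, u₂, u₃, u₄, u₅} -- FrdI:Prop1.11(vii) · NODES=DISCHARGED · DAGL1q · `_holds`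
  ∧ N_FrdI_Prop1_13_i.{u₁, u₂, u₃, u₄, u₅} -- FrdI:Prop1.13(i) · NODES=DISCHARGED · DAGL1q · `_holds`
  ∧ N_FrdI_Prop1_13_ii.{u₁, u₂, u₃, u₄, u₅} -- FrdI:Prop1.13(ii) · NODES=DISCHARGED · DAGL1q · `_holds`
  ∧ N_FrdI_Prop1_13_iii.{u₁, u₂, u₃, u₄, u₅} -- FrdI:Prop1.13(iii) · NODES=DISCHARGED · DAGL1q · `_holds`
  ∧ N_FrdI_Prop1_4_i.{u₁, u₂, u₃, u₄, u₅} -- FrdI:Prop1.4(i) · NODES=DISCHARGED · DAGL1p · `_holds`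
  ∧ N_FrdI_Prop1_4_ii.{u₁, u₂, u₃, u₄, u₅} -- FrdI:Prop1.4(ii) · NODES=DISCHARGED · DAGL1p · `_holds`
  ∧ N_FrdI_Prop1_4_iii.{u₁, u₂, u₃, u₄, u₅} -- FrdI:Prop1.4(iii) · NODES=DISCHARGED · DAGL1p · `_holds`
  ∧ N_FrdI_Prop1_4_iv.{u₁, u₂, u₃, u₄, u₅} -- FrdI:Prop1.4(iv) · NODES=DISCHARGED · DAGL1p · `_holds`
  ∧ N_FrdI_Prop1_4_v.{u₁, u₂, u₃, u₄, u₅} -- FrdI:Prop1.4(v) · NODES=DISCHARGED · DAGL1p · `_holds`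
  ∧ N_FrdI_Prop1_9_i.{u₁, u₂, u₃, u₄, u₅} -- FrdI:Prop1.9(i) · NODES=DISCHARGED · DAGL1p · `_holds`
  ∧ N_FrdI_Prop1_9_ii.{u₁, u₂, u₃, u₄, u₅} -- FrdI:Prop1.9(ii) · NODES=DISCHARGED · DAGL1p · `_holds`
  ∧ N_FrdI_Prop1_9_iii.{u₁, u₂, u₃, u₄, u₅} -- FrdI:Prop1.9(iii) · NODES=DISCHARGED · DAGL1p · `_holds`
  ∧ N_FrdI_Prop1_9_iv.{u₁, u₂, u₃, u₄, u₅} -- FrdI:Prop1.9(iv) · NODES=DISCHARGED · DAGL1p · `_holds`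
  ∧ N_FrdI_Prop1_9_v.{u₁, u₂, u₃, u₄, u₅} -- FrdI:Prop1.9(v) · NODES=DISCHARGED · DAGL1q · `_holds`
  ∧ N_FrdI_Prop1_9_vi.{u₁, u₂, u₃, u₄, u₅} -- FrdI:Prop1.9(vi) · NODES=DISCHARGED · DAGL1q · `_holds`
  ∧ N_FrdI_Prop1_9_vii.{u₁, u₂, u₃, u₄, u₅} -- FrdI:Prop1.9(vii) · NODES=DISCHARGED · DAGL1q · `_holds`
  ∧ N_FrdI_Prop2_1_i.{u₁, u₂, u₃, u₄, u₅} -- FrdI:Prop2.1(i) · NODES=DISCHARGED · DAGL1r · `_holds`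
  ∧ N_FrdI_Prop2_1_ii.{u₁, u₂, u₃} -- FrdI:Prop2.1(ii) · NODES=DISCHARGED · DAGL1d · `_holds`
  ∧ N_FrdI_Prop2_2_i.{u₁, u₂, u₃, u₄, u₅} -- FrdI:Prop2.2(i) · NODES=DISCHARGED · DAGL1r · `_holds`
  ∧ N_FrdI_Prop2_2_i_P22_L01.{u₁, u₂, u₃, u₄, u₅} -- sub-row of FrdI:Prop2.2(i) · DAGL1x · `_holds`
  ∧ N_FrdI_Prop2_2_iv.{u₁, u₂, u₃, u₄, u₅} -- FrdI:Prop2.2(iv) · NODES=DISCHARGED · DAGL1r · `_holds`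
  ∧ N_FrdI_Prop2_5_i.{u₁, u₂, u₃, u₄, u₅} -- FrdI:Prop2.5(i) · NODES=DISCHARGED · DAGL1r · `_holds`
  ∧ N_FrdI_Prop2_5_iii.{u₁, u₂, u₃, u₄, u₅} -- FrdI:Prop2.5(iii) · NODES=DISCHARGED-partial · DAGL1r · `_holds`
  ∧ N_FrdI_Prop2_9_ii.{u₁, u₂, u₃, u₄, u₅} -- FrdI:Prop2.9(ii) · NODES=DISCHARGED · DAGL1r · `_holds`
  ∧ N_FrdI_Prop3_3_ii.{u₁, u₂, u₃, u₄, u₅} -- FrdI:Prop3.3(ii) · NODES=DISCHARGED · DAGL1r · `_holds`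
  ∧ N_FrdI_Prop3_3_iii.{u₁, u₂, u₃, u₄, u₅} -- FrdI:Prop3.3(iii) · NODES=DISCHARGED · DAGL1r · `_holds`
  ∧ N_FrdI_Prop3_3_v.{u₁, u₂, u₃, u₄, u₅} -- FrdI:Prop3.3(v) · NODES=DISCHARGED · DAGL1r · `_holds`
  ∧ N_FrdI_Prop2_2_iii_P22_L11.{u₁, u₂, u₃, u₄, u₅} -- sub-row of FrdI:Prop2.2(iii) (node itself residual) · DAGL1x · `_holds`
  ∧ N_FrdI_Thm3_4_iii_L01.{u₁, u₂, u₃, u₄, u₅} -- sub-row of FrdI:Thm3.4(iii) (node itself data-form/listed) · DAGL1x · `_holds`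
  ∧ N_FrdI_Thm3_4_iii_L03.{u₁, u₂, u₃, u₄, u₅} -- sub-row of FrdI:Thm3.4(iii) (node itself data-form/listed) · DAGL1x · `_holds`
  ∧ N_FrdI_Thm3_4_iii_L04.{u₁, u₂, u₃, u₄, u₅} -- sub-row of FrdI:Thm3.4(iii) (node itself data-form/listed) · DAGL1x · `_holds`
  ∧ N_FrdI_Thm3_4_iii_L05.{u₁, u₂, u₃, u₄, u₅} -- sub-row of FrdI:Thm3.4(iii) (node itself data-form/listed) · DAGL1x · `_holds`
  ∧ N_FrdI_Thm3_4_iii_L06.{u₁, u₂, u₃, u₄, u₅} -- sub-row of FrdI:Thm3.4(iii) (node itself data-form/listed) · DAGL1x · `_holds`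
  ∧ N_FrdI_Thm3_4_iii_L07.{u₁, u₂, u₃, u₄, u₅} -- sub-row of FrdI:Thm3.4(iii) (node itself data-form/listed) · DAGL1x · `_holds`
  ∧ N_FrdI_Thm3_4_v_L12o.{u₁, u₂, u₃, u₄, u₅} -- sub-row of FrdI:Thm3.4(v) (node itself data-form/listed) · DAGL1x · `_holds`

/-- `Layer1DischargedA` holds: the index witnesses BY NAME (nothing new). [claim: Mochizuki2012, status: disputed] -/
theorem layer1DischargedA_holds : Layer1DischargedA.{u₁, u₂, u₃, u₄, u₅} :=
  ⟨N_FrdI_Cor2_6_holds,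
    N_FrdI_Def2_3_iv_holds,
    N_FrdI_Def2_4_ii_holds,
    N_FrdI_Def2_4_iii_holds,
    N_FrdI_Def2_7_i_holds,
    N_FrdI_Prop1_10_i_holds,
    N_FrdI_Prop1_10_ii_holds,
    N_FrdI_Prop1_10_iii_holds,
    N_FrdI_Prop1_10_iv_holds,
    N_FrdI_Prop1_10_v_holds,
    N_FrdI_Prop1_10_vi_holds,
    N_FrdI_Prop1_11_i_holds,
    N_FrdI_Prop1_11_ii_holds,
    N_FrdI_Prop1_11_iii_holds,
    N_FrdI_Prop1_11_iv_holds,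
    N_FrdI_Prop1_11_v_holds,
    N_FrdI_Prop1_11_vi_holds,
    N_FrdI_Prop1_11_vii_holds,
    N_FrdI_Prop1_13_i_holds,
    N_FrdI_Prop1_13_ii_holds,
    N_FrdI_Prop1_13_iii_holds,
    N_FrdI_Prop1_4_i_holds,
    N_FrdI_Prop1_4_ii_holds,
    N_FrdI_Prop1_4_iii_holds,
    N_FrdI_Prop1_4_iv_holds,
    N_FrdI_Prop1_4_v_holds,
    N_FrdI_Prop1_9_i_holds,
    N_FrdI_Prop1_9_ii_holds,
    N_FrdI_Prop1_9_iii_holds,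
    N_FrdI_Prop1_9_iv_holds,
    N_FrdI_Prop1_9_v_holds,
    N_FrdI_Prop1_9_vi_holds,
    N_FrdI_Prop1_9_vii_holds,
    N_FrdI_Prop2_1_i_holds,
    N_FrdI_Prop2_1_ii_holds,
    N_FrdI_Prop2_2_i_holds,
    N_FrdI_Prop2_2_i_P22_L01_holds,
    N_FrdI_Prop2_2_iv_holds,
    N_FrdI_Prop2_5_i_holds,
    N_FrdI_Prop2_5_iii_holds,
    N_FrdI_Prop2_9_ii_holds,
    N_FrdI_Prop3_3_ii_holds,
    N_FrdI_Prop3_3_iii_holds,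
    N_FrdI_Prop3_3_v_holds,
    N_FrdI_Prop2_2_iii_P22_L11_holds,
    N_FrdI_Thm3_4_iii_L01_holds,
    N_FrdI_Thm3_4_iii_L03_holds,
    N_FrdI_Thm3_4_iii_L04_holds,
    N_FrdI_Thm3_4_iii_L05_holds,
    N_FrdI_Thm3_4_iii_L06_holds,
    N_FrdI_Thm3_4_iii_L07_holds,
    N_FrdI_Thm3_4_v_L12o_holds⟩

/-- **L1 residual, part A** ([FrdI] §1–§3): the index Props of the cone nodes NODES does not (yet) mark discharged — the C-scoreboard entries
of this slice. [claim: Mochizuki2012, status: disputed] -/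
def Layer1ResidualA : Prop :=
  N_FrdI_Def1_1_i.{u₁} -- FrdI:Def1.1(i) · NODES=ACCEPTED · DAGL1d · `_holds`
  ∧ N_FrdI_Def1_1_ii.{u₁, u₂, u₃} -- FrdI:Def1.1(ii) · NODES=ACCEPTED · DAGL1d · `_holds`
  ∧ N_FrdI_Def1_1_iii.{u₁, u₂, u₃} -- FrdI:Def1.1(iii) · NODES=ACCEPTED · DAGL1d · `_holds`
  ∧ N_FrdI_Def1_3_i.{u₁, u₂, u₃, u₄, u₅} -- FrdI:Def1.3(i) · NODES=ACCEPTED · DAGL1p · `_holds`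
  ∧ N_FrdI_Def1_3_v.{u₁, u₂, u₃, u₄, u₅} -- FrdI:Def1.3(v) · NODES=ACCEPTED · DAGL1p · `_holds`
  ∧ N_FrdI_Prop2_2_ii.{u₁, u₂, u₃, u₄, u₅} -- FrdI:Prop2.2(ii) · NODES=ACCEPTED · DAGL1r · `_part`
  ∧ N_FrdI_Prop2_2_iii.{u₁, u₂, u₃, u₄, u₅} -- FrdI:Prop2.2(iii) · NODES=ACCEPTED · DAGL1r · `_part`

/-- The [FrdI] §1–§3 slice of the L1 cone: discharged ∧ residual. [claim: Mochizuki2012, status: disputed] -/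
def Layer1ConeA : Prop :=
  Layer1DischargedA.{u₁, u₂, u₃, u₄, u₅} ∧ Layer1ResidualA.{u₁, u₂, u₃, u₄, u₅}

/-- The slice follows from its residual alone (the discharged half is witnessed BY NAME). [claim: Mochizuki2012, status: disputed] -/
theorem layer1ConeA_of (h : Layer1ResidualA.{u₁, u₂, u₃, u₄, u₅}) : Layer1ConeA.{u₁, u₂, u₃, u₄, u₅} :=
  ⟨layer1DischargedA_holds.{u₁, u₂, u₃, u₄, u₅}, h⟩

/-! ### d_data rows and findings — NAME-CHECKED ONLY (the build breaks if an index name drifts; no Prop is asserted) -/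
example := @N_FrdI_Def1_1_iv -- FrdI:Def1.1(iv) [data-form, listed]
example := @N_FrdI_Def1_2_i -- FrdI:Def1.2(i) [data-form, listed]
example := @N_FrdI_Def1_2_ii -- FrdI:Def1.2(ii) [data-form, listed]
example := @N_FrdI_Def1_2_iii -- FrdI:Def1.2(iii) [data-form, listed]
example := @N_FrdI_Def1_2_iv -- FrdI:Def1.2(iv) [data-form, listed]
example := @N_FrdI_Def1_2_v -- FrdI:Def1.2(v) [data-form, listed]
example := @N_FrdI_Def1_3_ii -- FrdI:Def1.3(ii) [data-form, listed]
example := @N_FrdI_Def1_3_iii -- FrdI:Def1.3(iii) [data-form, listed]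
example := @N_FrdI_Def1_3_iv -- FrdI:Def1.3(iv) [data-form, listed]
example := @N_FrdI_Def1_3_vi -- FrdI:Def1.3(vi) [data-form, listed]
example := @N_FrdI_Def1_3_vii -- FrdI:Def1.3(vii) [data-form, listed]
example := @N_FrdI_Def2_4_i -- FrdI:Def2.4(i) [data-form, listed]
example := @N_FrdI_Def2_7_ii -- FrdI:Def2.7(ii) [data-form, listed]
example := @N_FrdI_Def2_7_iii -- FrdI:Def2.7(iii) [data-form, listed]
example := @N_FrdI_Def2_8_i -- FrdI:Def2.8(i) [data-form, listed]
example := @N_FrdI_Def2_8_ii -- FrdI:Def2.8(ii) [data-form, listed]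
example := @N_FrdI_Def2_8_iii -- FrdI:Def2.8(iii) [data-form, listed]
example := @N_FrdI_Prop2_1_iii -- FrdI:Prop2.1(iii) [data-form, listed]
example := @N_FrdI_Prop2_5_ii -- FrdI:Prop2.5(ii) [data-form, listed]
example := @N_FrdI_Prop2_9_i -- FrdI:Prop2.9(i) [data-form, listed]
example := @N_FrdI_Prop3_2_i -- FrdI:Prop3.2(i) [data-form, listed]
example := @N_FrdI_Prop3_2_ii -- FrdI:Prop3.2(ii) [data-form, listed]
example := @N_FrdI_Prop3_2_iii -- FrdI:Prop3.2(iii) [data-form, listed]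
example := @N_FrdI_Prop3_3_i -- FrdI:Prop3.3(i) [data-form, listed]
example := @N_FrdI_Prop3_3_iv -- FrdI:Prop3.3(iv) [data-form, listed]
example := @N_FrdI_Thm3_4_i -- FrdI:Thm3.4(i) [data-form, listed]
example := @N_FrdI_Thm3_4_ii -- FrdI:Thm3.4(ii) [data-form, listed]
example := @N_FrdI_Thm3_4_iii -- FrdI:Thm3.4(iii) [data-form, listed]
example := @N_FrdI_Thm3_4_iv -- FrdI:Thm3.4(iv) [data-form, listed]
example := @N_FrdI_Thm3_4_v -- FrdI:Thm3.4(v) [data-form, listed]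
example := @N_FrdI_Def3_1_i -- FrdI:Def3.1(i) [FINDING R121 (6): mis-keyed to [FrdII] Def 3.1 decls; not conjoined]
example := @N_FrdI_Def3_1_ii.{u₁} -- FrdI:Def3.1(ii) [FINDING R121 (6): mis-keyed to [FrdII] Def 3.1 decls; not conjoined]
example := @N_FrdI_Def3_1_iii.{u₁} -- FrdI:Def3.1(iii) [FINDING R121 (6): mis-keyed to [FrdII] Def 3.1 decls; not conjoined]
example := @N_FrdI_Def3_1_iv -- FrdI:Def3.1(iv) [FINDING R121 (6): mis-keyed to [FrdII] Def 3.1 decls; not conjoined]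

/-! ## v2 (append-only; abc-iut-L1-d4 gen 5, 2026-08-26T09:2xZ) — index RE-KEY swap requested by abc-iut-c312-2 08:52:10Z

The index owner re-keyed the four mis-resolved [FrdI] Def 3.1 aliases (v1 FINDINGS, R121 (6) / F-w6d007-1) as append-only primed
siblings in `DAGRf.lean` (p432413): `N_FrdI_Def3_1_i'` (claim-form, `_holds` = `IsSlim.isFrobeniusSlim`), `N_FrdI_Def3_1_ii'` /
`_iii'` (data: `PerfectionData`), `N_FrdI_Def3_1_iv'` (claim-form, `_holds` = `UnitEquiv.refl ∧ unitEquiv_iff_eq_of_isUnitTrivialType`),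
all keyed to the file of record `BaseCategoryTheoreticityDefs.lean`.  v2 COUNT LINE: **84 = d 43 + r 9 (v1's 7 + Def 3.1 (i)(iv),
NODES=ACCEPTED) + d_data 32 (v1's 30 + Def 3.1 (ii)(iii)) + findings 0.**  New declarations (v1's stay verbatim, append-only rule
«deprecate, don't mutate»): `Layer1ResidualA_v2` (= v1's conjuncts ∧ the two primed claim-form Props; universes u₁…u₅),
`Layer1ConeA_v2`, `layer1ConeA_v2_of`; `Layer1DischargedA` / `layer1DischargedA_holds` are unchanged and shared.  The apex should bind
`Layer1ResidualA_v2` (via `Layer1Residual_v2` of the top file) from now on.  [claim: Mochizuki2012, status: disputed] -/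

/-- **L1 residual, part A, v2** ([FrdI] §1–§3; 9 conjuncts): v1's seven ∧ the re-keyed [FrdI] Def 3.1 (i)/(iv) claim-form index Props.
No theorem is offered for this conjunction (K2b). [claim: Mochizuki2012, status: disputed] -/
def Layer1ResidualA_v2 : Prop :=
  N_FrdI_Def1_1_i.{u₁} -- FrdI:Def1.1(i) · NODES=ACCEPTED · DAGL1d · `_holds`
  ∧ N_FrdI_Def1_1_ii.{u₁, u₂, u₃} -- FrdI:Def1.1(ii) · NODES=ACCEPTED · DAGL1d · `_holds`
  ∧ N_FrdI_Def1_1_iii.{u₁, u₂, u₃} -- FrdI:Def1.1(iii) · NODES=ACCEPTED · DAGL1d · `_holds`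
  ∧ N_FrdI_Def1_3_i.{u₁, u₂, u₃, u₄, u₅} -- FrdI:Def1.3(i) · NODES=ACCEPTED · DAGL1p · `_holds`
  ∧ N_FrdI_Def1_3_v.{u₁, u₂, u₃, u₄, u₅} -- FrdI:Def1.3(v) · NODES=ACCEPTED · DAGL1p · `_holds`
  ∧ N_FrdI_Prop2_2_ii.{u₁, u₂, u₃, u₄, u₅} -- FrdI:Prop2.2(ii) · NODES=ACCEPTED · DAGL1r · `_part`
  ∧ N_FrdI_Prop2_2_iii.{u₁, u₂, u₃, u₄, u₅} -- FrdI:Prop2.2(iii) · NODES=ACCEPTED · DAGL1r · `_part`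
  ∧ N_FrdI_Def3_1_i'.{u₁, u₂} -- FrdI:Def3.1(i) · NODES=ACCEPTED · DAGRf (re-keyed sibling of N_FrdI_Def3_1_i) · `_holds`
  ∧ N_FrdI_Def3_1_iv'.{u₁, u₂, u₃, u₄, u₅} -- FrdI:Def3.1(iv) · NODES=ACCEPTED · DAGRf (re-keyed sibling of N_FrdI_Def3_1_iv) · `_holds`

/-- The [FrdI] §1–§3 slice of the L1 cone, v2: discharged ∧ residual (v2). [claim: Mochizuki2012, status: disputed] -/
def Layer1ConeA_v2 : Prop :=
  Layer1DischargedA.{u₁, u₂, u₃, u₄, u₅} ∧ Layer1ResidualA_v2.{u₁, u₂, u₃, u₄, u₅}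

/-- The v2 slice follows from its residual alone (the discharged half is witnessed BY NAME). [claim: Mochizuki2012, status: disputed] -/
theorem layer1ConeA_v2_of (h : Layer1ResidualA_v2.{u₁, u₂, u₃, u₄, u₅}) : Layer1ConeA_v2.{u₁, u₂, u₃, u₄, u₅} :=
  ⟨layer1DischargedA_holds.{u₁, u₂, u₃, u₄, u₅}, h⟩

/-! ### v2 d_data rows (re-keyed) — NAME-CHECKED ONLY -/
example := @N_FrdI_Def3_1_ii' -- FrdI:Def3.1(ii) [data-form, listed; re-keyed sibling, DAGRf]
example := @N_FrdI_Def3_1_iii' -- FrdI:Def3.1(iii) [data-form, listed; re-keyed sibling, DAGRf]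

end Summit.ABC.IUTFork.Conditional
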